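import Summits.CriticalPhenomena.PercolationContinuityZ3.Theorems.PercNearOneGluingNoHeavyLowerTailSwitchRelaxCheckV
import Summits.CriticalPhenomena.PercolationContinuityZ3.Theorems.PercNearOneGluingNoHeavyLowerTailSwitchRelaxCheckNSound
import HarnessLib

/-!
# `NoHeavyLowerTail` (stmt-CriticalPhenomena-4575) — SPECTATOR SLICES [0] of the one-step FOUR-copy switching certificate `r3inc`
# for the generic increasing QUARTIC row `E4(U[a|b], U[a|c], U[b|c], U[abc|y]) ≥ 0` on four points: data and scalable kernel checks (file A)

Support file (prover prim-masterthm-p1 gen 3; `--supports stmt-CriticalPhenomena-4575`).  No named facts, no sorries.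

SPECTATOR SLICING (prim-masterthm-p1 SCHEMA-K §10.3).  A Σ₂(4,4) certificate (copies X, Y, Z active, one spectator copy W never touched) for
`E₄(row) ≥ 0` is the same thing as 15 THREE-copy certificates `c_q` (q = type of W) — each pointwise sound on every finite graph — whose expectations
satisfy `Σ_q P_q·E[S_q] = −2·E₄ʰᵒᵐ` in the 15 type masses.  This file transcribes slices of `r3inc` (prim-masterthm-p1 certs-g2/K4onestep-inc/,
exact integer identity + complete-enumeration verdict + realcheck) into prim-cert-2's `SwitchRelax.Cert` (pool X2: one-step words `u>Y`, `u>Z`;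
types in `FourPointAtoms.pat4` order; potentials × 2) with the scalable kernel check of `…SwitchRelaxCheckN/V` (per input type: coverage `coverN` +
vectorised pair check `vecCheckN`), giving `S_q ≤ 0` pointwise (`Sreal_nonpos`, by `Cert.soundN`).  Every slice was re-verified offline in
prim-cert-2's independent relaxation (relaxN.analyse: max 0 at all 15 input types).  The quartic identity and the measure-level theorem
`0 ≤ sahiE4 …` are in `…SwitchRelaxK4R3Measure`.
-/

namespace Summit.CriticalPhenomena.PercolationContinuityZ3.Theorems

namespace SwitchRelax

namespace K4R3

/- The kernel checks below are memory-bound; elaborating them one at a time keeps each within the farm's memory cap. -/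
set_option Elab.async false
namespace S00

/-! #### Slice `0` (spectator type `0` of `FourPointAtoms.pat4`): 0 programs; λ₀ with 0 entries -/


/-- Slice 0: entries of the input potential `λ₀` (× 2). [this work] -/
def ents0 : List (Ty × Ty × Ty × ℤ) :=
  []

/-- Slice 0 as a three-copy certificate (root sets []; `λ₀` read from `ents0`). [this work] -/
def cert : Cert where
  RS := []
  progs := []
  lam0 := lookup3 ents0

/-- Well-formedness of the data (kernel). [this work] -/
theorem wf_cert : cert.wf = true := by decide +kernel

/-- The programs' potentials, tabulated (`bucket2`). [this work] -/
def TPb : List (List (List ℤ)) := []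

/-- `TPb` tabulates the programs' potentials. [this work] -/
theorem TPb_ok : List.Forall₂ (fun p T => TabOK p.lam T) cert.progs TPb :=
  List.Forall₂.nil

/-- The input potential, tabulated (`bucket3`). [this work] -/
def T03 : List (List (List ℤ)) := bucket3 ents0

/-- Signature codes of copy `Y`, per input type (offline-deduplicated, fingerprint-mixed). [this work] -/
def LYs : List (List ℕ) :=
  [[0],
    [0],
    [0],
    [0],
    [0],
    [0],
    [0],
    [0],
    [0],
    [0],
    [0],
    [0],
    [0],
    [0],
    [0]]

/-- Signature codes of copy `Z`, per input type (offline-deduplicated, fingerprint-mixed). [this work] -/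
def LZs : List (List ℕ) :=
  [[0],
    [0],
    [0],
    [0],
    [0],
    [0],
    [0],
    [0],
    [0],
    [0],
    [0],
    [0],
    [0],
    [0],
    [0]]

/-- Slice 0: coverage at input type `0` (15 states; kernel). [this work] -/ theorem cover_0 :
    cert.coverN 0 (getN T03 0 []) TPb (getN LYs 0 []) (getN LZs 0 []) = true := by decide +kernel
/-- Slice 0: vectorised pair check at input type `0` (1×1 code pairs; kernel). [this work] -/ theorem vec_0 :
    vecCheckN (getN T03 0 []) TPb (getN LYs 0 []) (getN LZs 0 []) = true := by decide +kernel
/-- Slice 0: coverage at input type `1` (15 states; kernel). [this work] -/ theorem cover_1 :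
    cert.coverN 1 (getN T03 1 []) TPb (getN LYs 1 []) (getN LZs 1 []) = true := by decide +kernel
/-- Slice 0: vectorised pair check at input type `1` (1×1 code pairs; kernel). [this work] -/ theorem vec_1 :
    vecCheckN (getN T03 1 []) TPb (getN LYs 1 []) (getN LZs 1 []) = true := by decide +kernel
/-- Slice 0: coverage at input type `2` (15 states; kernel). [this work] -/ theorem cover_2 :
    cert.coverN 2 (getN T03 2 []) TPb (getN LYs 2 []) (getN LZs 2 []) = true := by decide +kernel
/-- Slice 0: vectorised pair check at input type `2` (1×1 code pairs; kernel). [this work] -/ theorem vec_2 :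
    vecCheckN (getN T03 2 []) TPb (getN LYs 2 []) (getN LZs 2 []) = true := by decide +kernel
/-- Slice 0: coverage at input type `3` (15 states; kernel). [this work] -/ theorem cover_3 :
    cert.coverN 3 (getN T03 3 []) TPb (getN LYs 3 []) (getN LZs 3 []) = true := by decide +kernel
/-- Slice 0: vectorised pair check at input type `3` (1×1 code pairs; kernel). [this work] -/ theorem vec_3 :
    vecCheckN (getN T03 3 []) TPb (getN LYs 3 []) (getN LZs 3 []) = true := by decide +kernel
/-- Slice 0: coverage at input type `4` (15 states; kernel). [this work] -/ theorem cover_4 :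
    cert.coverN 4 (getN T03 4 []) TPb (getN LYs 4 []) (getN LZs 4 []) = true := by decide +kernel
/-- Slice 0: vectorised pair check at input type `4` (1×1 code pairs; kernel). [this work] -/ theorem vec_4 :
    vecCheckN (getN T03 4 []) TPb (getN LYs 4 []) (getN LZs 4 []) = true := by decide +kernel
/-- Slice 0: coverage at input type `5` (15 states; kernel). [this work] -/ theorem cover_5 :
    cert.coverN 5 (getN T03 5 []) TPb (getN LYs 5 []) (getN LZs 5 []) = true := by decide +kernel
/-- Slice 0: vectorised pair check at input type `5` (1×1 code pairs; kernel). [this work] -/ theorem vec_5 :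
    vecCheckN (getN T03 5 []) TPb (getN LYs 5 []) (getN LZs 5 []) = true := by decide +kernel
/-- Slice 0: coverage at input type `6` (15 states; kernel). [this work] -/ theorem cover_6 :
    cert.coverN 6 (getN T03 6 []) TPb (getN LYs 6 []) (getN LZs 6 []) = true := by decide +kernel
/-- Slice 0: vectorised pair check at input type `6` (1×1 code pairs; kernel). [this work] -/ theorem vec_6 :
    vecCheckN (getN T03 6 []) TPb (getN LYs 6 []) (getN LZs 6 []) = true := by decide +kernel
/-- Slice 0: coverage at input type `7` (15 states; kernel). [this work] -/ theorem cover_7 :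
    cert.coverN 7 (getN T03 7 []) TPb (getN LYs 7 []) (getN LZs 7 []) = true := by decide +kernel
/-- Slice 0: vectorised pair check at input type `7` (1×1 code pairs; kernel). [this work] -/ theorem vec_7 :
    vecCheckN (getN T03 7 []) TPb (getN LYs 7 []) (getN LZs 7 []) = true := by decide +kernel
/-- Slice 0: coverage at input type `8` (15 states; kernel). [this work] -/ theorem cover_8 :
    cert.coverN 8 (getN T03 8 []) TPb (getN LYs 8 []) (getN LZs 8 []) = true := by decide +kernel
/-- Slice 0: vectorised pair check at input type `8` (1×1 code pairs; kernel). [this work] -/ theorem vec_8 :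
    vecCheckN (getN T03 8 []) TPb (getN LYs 8 []) (getN LZs 8 []) = true := by decide +kernel
/-- Slice 0: coverage at input type `9` (15 states; kernel). [this work] -/ theorem cover_9 :
    cert.coverN 9 (getN T03 9 []) TPb (getN LYs 9 []) (getN LZs 9 []) = true := by decide +kernel
/-- Slice 0: vectorised pair check at input type `9` (1×1 code pairs; kernel). [this work] -/ theorem vec_9 :
    vecCheckN (getN T03 9 []) TPb (getN LYs 9 []) (getN LZs 9 []) = true := by decide +kernel
/-- Slice 0: coverage at input type `10` (15 states; kernel). [this work] -/ theorem cover_10 :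
    cert.coverN 10 (getN T03 10 []) TPb (getN LYs 10 []) (getN LZs 10 []) = true := by decide +kernel
/-- Slice 0: vectorised pair check at input type `10` (1×1 code pairs; kernel). [this work] -/ theorem vec_10 :
    vecCheckN (getN T03 10 []) TPb (getN LYs 10 []) (getN LZs 10 []) = true := by decide +kernel
/-- Slice 0: coverage at input type `11` (15 states; kernel). [this work] -/ theorem cover_11 :
    cert.coverN 11 (getN T03 11 []) TPb (getN LYs 11 []) (getN LZs 11 []) = true := by decide +kernel
/-- Slice 0: vectorised pair check at input type `11` (1×1 code pairs; kernel). [this work] -/ theorem vec_11 :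
    vecCheckN (getN T03 11 []) TPb (getN LYs 11 []) (getN LZs 11 []) = true := by decide +kernel
/-- Slice 0: coverage at input type `12` (15 states; kernel). [this work] -/ theorem cover_12 :
    cert.coverN 12 (getN T03 12 []) TPb (getN LYs 12 []) (getN LZs 12 []) = true := by decide +kernel
/-- Slice 0: vectorised pair check at input type `12` (1×1 code pairs; kernel). [this work] -/ theorem vec_12 :
    vecCheckN (getN T03 12 []) TPb (getN LYs 12 []) (getN LZs 12 []) = true := by decide +kernel
/-- Slice 0: coverage at input type `13` (15 states; kernel). [this work] -/ theorem cover_13 :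
    cert.coverN 13 (getN T03 13 []) TPb (getN LYs 13 []) (getN LZs 13 []) = true := by decide +kernel
/-- Slice 0: vectorised pair check at input type `13` (1×1 code pairs; kernel). [this work] -/ theorem vec_13 :
    vecCheckN (getN T03 13 []) TPb (getN LYs 13 []) (getN LZs 13 []) = true := by decide +kernel
/-- Slice 0: coverage at input type `14` (15 states; kernel). [this work] -/ theorem cover_14 :
    cert.coverN 14 (getN T03 14 []) TPb (getN LYs 14 []) (getN LZs 14 []) = true := by decide +kernel
/-- Slice 0: vectorised pair check at input type `14` (1×1 code pairs; kernel). [this work] -/ theorem vec_14 :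
    vecCheckN (getN T03 14 []) TPb (getN LYs 14 []) (getN LZs 14 []) = true := by decide +kernel

/-- **Slice 0 is pointwise sound**: `S ≤ 0` at every configuration triple of every finite graph. [this work] -/
theorem Sreal_nonpos {V : Type*} [Fintype V] [DecidableEq V] (τ : Fin 4 → V) (x : Fin 3 → Finset (Sym2 V)) :
    Sreal τ cert x ≤ 0 :=
  cert.soundN τ wf_cert (cert.okAt_all
    ⟨_, _, _, _, tabOK_bucket3 ents0 0, TPb_ok, cover_0, pairOK_of_vecCheckN vec_0⟩
    ⟨_, _, _, _, tabOK_bucket3 ents0 1, TPb_ok, cover_1, pairOK_of_vecCheckN vec_1⟩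
    ⟨_, _, _, _, tabOK_bucket3 ents0 2, TPb_ok, cover_2, pairOK_of_vecCheckN vec_2⟩
    ⟨_, _, _, _, tabOK_bucket3 ents0 3, TPb_ok, cover_3, pairOK_of_vecCheckN vec_3⟩
    ⟨_, _, _, _, tabOK_bucket3 ents0 4, TPb_ok, cover_4, pairOK_of_vecCheckN vec_4⟩
    ⟨_, _, _, _, tabOK_bucket3 ents0 5, TPb_ok, cover_5, pairOK_of_vecCheckN vec_5⟩
    ⟨_, _, _, _, tabOK_bucket3 ents0 6, TPb_ok, cover_6, pairOK_of_vecCheckN vec_6⟩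
    ⟨_, _, _, _, tabOK_bucket3 ents0 7, TPb_ok, cover_7, pairOK_of_vecCheckN vec_7⟩
    ⟨_, _, _, _, tabOK_bucket3 ents0 8, TPb_ok, cover_8, pairOK_of_vecCheckN vec_8⟩
    ⟨_, _, _, _, tabOK_bucket3 ents0 9, TPb_ok, cover_9, pairOK_of_vecCheckN vec_9⟩
    ⟨_, _, _, _, tabOK_bucket3 ents0 10, TPb_ok, cover_10, pairOK_of_vecCheckN vec_10⟩
    ⟨_, _, _, _, tabOK_bucket3 ents0 11, TPb_ok, cover_11, pairOK_of_vecCheckN vec_11⟩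
    ⟨_, _, _, _, tabOK_bucket3 ents0 12, TPb_ok, cover_12, pairOK_of_vecCheckN vec_12⟩
    ⟨_, _, _, _, tabOK_bucket3 ents0 13, TPb_ok, cover_13, pairOK_of_vecCheckN vec_13⟩
    ⟨_, _, _, _, tabOK_bucket3 ents0 14, TPb_ok, cover_14, pairOK_of_vecCheckN vec_14⟩) x

end S00

end K4R3

end SwitchRelax

end Summit.CriticalPhenomena.PercolationContinuityZ3.Theorems
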